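import Summits.KontsevichZagierPeriods.KontsevichZagierPeriods.Theorems.LiouvilleUnfoldingLogPrimitiveNLStubDescentCells
import Literature.NumberTheory.Transcendental.SemialgebraicLineDeriv
import Literature.ModelTheory.ExponentialFields.RealClosedFieldTheoryProofs
import Literature.ModelTheory.ExponentialFields.SemialgebraicInterior
import Literature.NumberTheory.Transcendental.KZLogCalculusProofs
import HarnessLib

/-!
# `LogPrimitiveNL` (stmt-KontsevichZagierPeriods-2836), line `ax-schanuel-germs`, stub
`stub_uniformCells` — part 1: the local kernel of the log-gradient matrix and its strata

For an (open) `ℚ`-semialgebraic `U₁ ⊆ ℝⁿ` and a matrix `Ω j i` (`j : Fin n`, `i : Fin k`) of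
`ℚ`-semialgebraic functions on `U₁` (downstream: `Ω j i = ∂ⱼWᵢ / Wᵢ`), the *local kernel* at `x` is
the real subspace `L x = {f ∈ ℝᵏ | ∃ r > 0, ∀ y ∈ U₁, dist y x < r → ∀ j, ∑ᵢ fᵢ Ω j i y = 0}` of
vectors killed by `Ω` on a whole neighbourhood of `x` in `U₁`. This file proves:

* `uniformCells_isSemialgebraic_strata` — the strata `{x ∈ U₁ | dim L x = d}` are `ℚ`-semialgebraic:
  `d ≤ dim L x` iff there are `d` linearly independent vectors in `L x`, a first-order condition over
  the graphs of the `Ω j i`, realised with Mathlib's `Set.Definable` API and the tree's bridge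
  `definable_iff_isSemialgebraic_real` (Tarski–Seidenberg; Basu–Pollack–Roy 2006, Cor. 2.78);
* `uniformCells_eventually_le`, `uniformCells_eq_of_isPreconnected` — `L` is monotone along
  convergence (`L x ≤ L y` for `y` near `x`), hence constant on every preconnected set on which
  `dim L` is constant.

All of it is folklore real semialgebraic geometry / linear algebra.
-/

noncomputable section

open Set MeasureTheory Filter
open scoped ContDiff Topology LaurentSeries RatFunc
open Literature.NumberTheory.Transcendental Literature.ModelTheory.ExponentialFields

namespace Summit.KontsevichZagierPeriods.LiouvilleUnfolding.LogPrimitiveNL.AxSchanuelGerms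

open FirstOrder MvPolynomial

/-! ### First-order descriptions (definable sets of the real ordered field, rational parameters) -/

/-- The graph relation `v a = g (v ∘ ι)` (together with `v ∘ ι ∈ U₁`) of a `ℚ`-semialgebraic
function `g` on `U₁`, read in any finite set of variables `α` through `ι : Fin n → α`, `a : α`, is
definable in the real ordered field with rational parameters (semialgebraic ⟹ definable, then a
relabelling of variables). [folklore] -/
theorem uniformCells_definable_graph {n : ℕ} {U₁ : Set (Fin n → ℝ)} {g : (Fin n → ℝ) → ℝ}
    (hg : IsSemialgebraicFunOn ℚ U₁ g) {α : Type} (ι : Fin n → α) (a : α) :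
    (range ((↑) : ℚ → ℝ)).Definable Language.orderedRing
      {v : α → ℝ | v ∘ ι ∈ U₁ ∧ v a = g (v ∘ ι)} := by
  have h := (definable_of_isSemialgebraic (isSemialgebraicFunOn_iff.mp hg)).preimage_comp
    (Fin.snoc ι a : Fin (n + 1) → α)
  convert h using 1
  ext v
  have h1 : Fin.init (v ∘ (Fin.snoc ι a : Fin (n + 1) → α)) = v ∘ ι := by
    funext l
    simp [Fin.init]
  simp only [mem_setOf_eq, mem_preimage, h1, Function.comp_apply, Fin.snoc_last]

/-- The pointwise kernel condition `∀ j, ∑ᵢ fᵢ Ω j i y = 0` (together with `y ∈ U₁`), the vector `f`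
and the point `y` being read in the variables `α` through `ιf`, `ιy`, is definable with rational
parameters: graph elimination `∀ w, (∀ j i, w (j, i) = Ω j i y) → ∀ j, ∑ᵢ fᵢ w (j, i) = 0`.
[folklore] -/
theorem uniformCells_definable_zero {n k : ℕ} {U₁ : Set (Fin n → ℝ)} (hU₁ : IsSemialgebraic ℚ U₁)
    {Ω : Fin n → Fin k → (Fin n → ℝ) → ℝ} (hΩ : ∀ j i, IsSemialgebraicFunOn ℚ U₁ (Ω j i))
    {α : Type} (ιy : Fin n → α) (ιf : Fin k → α) :
    (range ((↑) : ℚ → ℝ)).Definable Language.orderedRing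
      {v : α → ℝ | v ∘ ιy ∈ U₁ ∧ ∀ j, ∑ i, v (ιf i) * Ω j i (v ∘ ιy) = 0} := by
  classical
  -- the graph relations `w (j, i) = Ω j i y`, in the variables `α ⊕ (Fin n × Fin k)`
  have hG : (range ((↑) : ℚ → ℝ)).Definable Language.orderedRing
      (⋂ p : Fin n × Fin k, {u : α ⊕ (Fin n × Fin k) → ℝ |
        u ∘ (Sum.inl ∘ ιy) ∈ U₁ ∧ u (Sum.inr p) = Ω p.1 p.2 (u ∘ (Sum.inl ∘ ιy))}) :=
    definable_iInter_of_finite fun p => uniformCells_definable_graph (hΩ p.1 p.2) _ _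
  -- the linear conditions `∑ i, f i * w (j, i) = 0`
  have hP : (range ((↑) : ℚ → ℝ)).Definable Language.orderedRing
      (⋂ j : Fin n, {u : α ⊕ (Fin n × Fin k) → ℝ |
        aeval u (∑ i : Fin k, X (Sum.inl (ιf i)) * X (Sum.inr (j, i)) :
          MvPolynomial (α ⊕ (Fin n × Fin k)) ℚ) = 0}) :=
    definable_iInter_of_finite fun j => definable_setOf_aeval_eq_zero _
  have hU : (range ((↑) : ℚ → ℝ)).Definable Language.orderedRing {v : α → ℝ | v ∘ ιy ∈ U₁} :=
    (definable_of_isSemialgebraic hU₁).preimage_comp ιy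
  convert hU.inter (hG.compl.union hP).forall_of_finite using 1
  ext v
  have hc : ∀ u : Fin n × Fin k → ℝ, Sum.elim v u ∘ (Sum.inl ∘ ιy) = v ∘ ιy := fun u => rfl
  simp only [mem_setOf_eq, mem_inter_iff, mem_union, mem_compl_iff, mem_iInter, map_sum, map_mul,
    aeval_X, Sum.elim_inl, Sum.elim_inr, hc]
  refine and_congr_right fun hy => ⟨fun h u => ?_, fun h j => ?_⟩
  · rw [or_iff_not_imp_left, not_not]
    intro hu j
    have hu' : ∀ i, u (j, i) = Ω j i (v ∘ ιy) := fun i => (hu (j, i)).2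
    simp only [hu']
    exact h j
  · rcases h (fun p => Ω p.1 p.2 (v ∘ ιy)) with h' | h'
    · exact absurd (fun p => ⟨hy, rfl⟩) h'
    · exact h' j

/-- Balls of the sup metric of `ℝⁿ` in polynomial terms: for `0 < r`,
`dist y x < r ↔ ∀ l, (y l - x l)² < r²`. [folklore] -/
theorem uniformCells_dist_lt_iff {n : ℕ} {x y : Fin n → ℝ} {r : ℝ} (hr : 0 < r) :
    dist y x < r ↔ ∀ l, (y l - x l) ^ 2 < r ^ 2 := by
  rw [dist_pi_lt_iff hr]
  refine forall_congr' fun l => ?_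
  rw [Real.dist_eq, sq_lt_sq, abs_of_pos hr]

/-- The *local* kernel condition `∃ r > 0, ∀ y ∈ U₁, dist y x < r → ∀ j, ∑ᵢ fᵢ Ω j i y = 0`
(membership of `f` in the local kernel at `x`), `x` and `f` being read in the variables `α` through
`ιx`, `ιf`, is definable with rational parameters (one existential and one universal block on top
of `uniformCells_definable_zero`). [folklore] -/
theorem uniformCells_definable_local {n k : ℕ} {U₁ : Set (Fin n → ℝ)} (hU₁ : IsSemialgebraic ℚ U₁)
    {Ω : Fin n → Fin k → (Fin n → ℝ) → ℝ} (hΩ : ∀ j i, IsSemialgebraicFunOn ℚ U₁ (Ω j i))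
    {α : Type} (ιx : Fin n → α) (ιf : Fin k → α) :
    (range ((↑) : ℚ → ℝ)).Definable Language.orderedRing
      {v : α → ℝ | ∃ r : ℝ, 0 < r ∧ ∀ y ∈ U₁, dist y (v ∘ ιx) < r →
        ∀ j, ∑ i, v (ιf i) * Ω j i y = 0} := by
  classical
  -- variables `((v, r), y) : (α ⊕ Unit) ⊕ Fin n`; `Z = {y ∈ U₁ ∧ ∀ j, ∑ i, f i * Ω j i y = 0}`
  have hZ := uniformCells_definable_zero hU₁ hΩ (α := (α ⊕ Unit) ⊕ Fin n) Sum.inr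
    (Sum.inl ∘ Sum.inl ∘ ιf)
  -- `B = {y ∈ U₁ ∧ ∀ l, (y l - x l)² < r²}`
  have hB : (range ((↑) : ℚ → ℝ)).Definable Language.orderedRing
      ({u : (α ⊕ Unit) ⊕ Fin n → ℝ | u ∘ Sum.inr ∈ U₁} ∩ ⋂ l : Fin n,
        {u | 0 < aeval u (X (Sum.inl (Sum.inr ())) ^ 2 -
          (X (Sum.inr l) - X (Sum.inl (Sum.inl (ιx l)))) ^ 2 :
            MvPolynomial ((α ⊕ Unit) ⊕ Fin n) ℚ)}) :=
    ((definable_of_isSemialgebraic hU₁).preimage_comp _).inter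
      (definable_iInter_of_finite fun l => definable_setOf_aeval_pos _)
  -- `0 < r`
  have hr : (range ((↑) : ℚ → ℝ)).Definable Language.orderedRing
      {w : α ⊕ Unit → ℝ | 0 < aeval w (X (Sum.inr ()) : MvPolynomial (α ⊕ Unit) ℚ)} :=
    definable_setOf_aeval_pos _
  convert (hr.inter (hB.compl.union hZ).forall_of_finite).exists_of_finite using 1
  ext v
  simp only [mem_setOf_eq, mem_inter_iff, mem_union, mem_compl_iff, mem_iInter, map_sub, map_pow,
    aeval_X, Sum.elim_inl, Sum.elim_inr, Sum.elim_comp_inr, Function.comp_apply, sub_pos]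
  constructor
  · rintro ⟨r, hr0, h⟩
    refine ⟨fun _ => r, hr0, fun y => ?_⟩
    rw [or_iff_not_imp_left, not_not]
    rintro ⟨hyU, hy⟩
    exact ⟨hyU, h y hyU ((uniformCells_dist_lt_iff hr0).2 hy)⟩
  · rintro ⟨u, hu0, h⟩
    refine ⟨u (), hu0, fun y hyU hy j => ?_⟩
    rcases h y with h' | h'
    · exact absurd ⟨hyU, (uniformCells_dist_lt_iff hu0).1 hy⟩ h'
    · exact h'.2 j

/-- Linear independence of `d` vectors of `ℝᵏ`, read in the variables `α` through `ιf`, is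
definable with rational parameters (`∀ c, ∑ₐ cₐ fₐ = 0 → c = 0`). [folklore] -/
theorem uniformCells_definable_linearIndependent {d k : ℕ} {α : Type} (ιf : Fin d → Fin k → α) :
    (range ((↑) : ℚ → ℝ)).Definable Language.orderedRing
      {v : α → ℝ | LinearIndependent ℝ (fun a i => v (ιf a i) : Fin d → Fin k → ℝ)} := by
  classical
  have h1 : (range ((↑) : ℚ → ℝ)).Definable Language.orderedRing
      (⋂ i : Fin k, {u : α ⊕ Fin d → ℝ |
        aeval u (∑ a : Fin d, X (Sum.inr a) * X (Sum.inl (ιf a i)) :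
          MvPolynomial (α ⊕ Fin d) ℚ) = 0}) :=
    definable_iInter_of_finite fun i => definable_setOf_aeval_eq_zero _
  have h2 : (range ((↑) : ℚ → ℝ)).Definable Language.orderedRing
      (⋂ a : Fin d, {u : α ⊕ Fin d → ℝ | aeval u (X (Sum.inr a) : MvPolynomial (α ⊕ Fin d) ℚ) = 0}) :=
    definable_iInter_of_finite fun a => definable_setOf_aeval_eq_zero _
  convert (h1.compl.union h2).forall_of_finite using 1
  ext v
  simp only [mem_setOf_eq, Fintype.linearIndependent_iff, mem_union, mem_compl_iff, mem_iInter,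
    map_sum, map_mul, aeval_X, Sum.elim_inl, Sum.elim_inr]
  refine forall_congr' fun g => ?_
  rw [or_iff_not_imp_left, not_not]
  have hsum : (∑ a, g a • (fun i => v (ιf a i)) = 0) ↔ ∀ i, ∑ a, g a * v (ιf a i) = 0 := by
    rw [funext_iff]
    simp only [Finset.sum_apply, Pi.smul_apply, smul_eq_mul, Pi.zero_apply]
  rw [hsum]

/-- **The rank loci are semialgebraic.** For `ℚ`-semialgebraic `Ω j i` on a `ℚ`-semialgebraic `U₁`,
the set of `x ∈ U₁` admitting `d` linearly independent vectors in the local kernel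
`{f | ∃ r > 0, ∀ y ∈ U₁, dist y x < r → ∀ j, ∑ᵢ fᵢ Ω j i y = 0}` is `ℚ`-semialgebraic
(a first-order description; Tarski–Seidenberg in the form definable = semialgebraic).
[cite: BasuPollackRoy2006, Cor. 2.78 (§2.5.1)] -/
theorem uniformCells_isSemialgebraic_rankLocus {n k : ℕ} {U₁ : Set (Fin n → ℝ)}
    (hU₁ : IsSemialgebraic ℚ U₁) {Ω : Fin n → Fin k → (Fin n → ℝ) → ℝ}
    (hΩ : ∀ j i, IsSemialgebraicFunOn ℚ U₁ (Ω j i)) (d : ℕ) :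
    IsSemialgebraic ℚ {x : Fin n → ℝ | x ∈ U₁ ∧ ∃ f : Fin d → Fin k → ℝ, LinearIndependent ℝ f ∧
      ∀ a, ∃ r : ℝ, 0 < r ∧ ∀ y ∈ U₁, dist y x < r → ∀ j, ∑ i, f a i * Ω j i y = 0} := by
  classical
  have hI := uniformCells_definable_linearIndependent (α := Fin n ⊕ (Fin d × Fin k)) (d := d)
    (k := k) fun a i => Sum.inr (a, i)
  have hLoc : (range ((↑) : ℚ → ℝ)).Definable Language.orderedRing
      (⋂ a : Fin d, {v : Fin n ⊕ (Fin d × Fin k) → ℝ | ∃ r : ℝ, 0 < r ∧ ∀ y ∈ U₁,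
        dist y (v ∘ Sum.inl) < r → ∀ j, ∑ i, v (Sum.inr (a, i)) * Ω j i y = 0}) :=
    definable_iInter_of_finite fun a =>
      uniformCells_definable_local hU₁ hΩ Sum.inl fun i => Sum.inr (a, i)
  refine isSemialgebraic_of_definable ?_
  convert (definable_of_isSemialgebraic hU₁).inter (hI.inter hLoc).exists_of_finite using 1
  ext x
  simp only [mem_setOf_eq, mem_inter_iff, mem_iInter, Sum.elim_inr, Sum.elim_comp_inl]
  refine and_congr_right fun _ => ⟨?_, ?_⟩
  · rintro ⟨f, hf, h⟩
    exact ⟨fun p => f p.1 p.2, hf, h⟩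
  · rintro ⟨u, hu, h⟩
    exact ⟨fun a i => u (a, i), hu, h⟩

/-! ### The local kernel as a family of subspaces -/

/-- `d ≤ dim L'` iff `L'` contains `d` linearly independent vectors. [folklore] -/
theorem uniformCells_le_finrank_iff {k d : ℕ} (L' : Submodule ℝ (Fin k → ℝ)) :
    d ≤ Module.finrank ℝ L' ↔ ∃ f : Fin d → Fin k → ℝ, LinearIndependent ℝ f ∧ ∀ a, f a ∈ L' := by
  constructor
  · intro hd
    obtain ⟨g, hg⟩ := exists_linearIndependent_of_le_finrank hd
    exact ⟨fun a => (g a : Fin k → ℝ), hg.map' L'.subtype (Submodule.ker_subtype _), fun a => (g a).2⟩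
  · rintro ⟨f, hf, hfL⟩
    have h : LinearIndependent ℝ (fun a => (⟨f a, hfL a⟩ : L')) :=
      LinearIndependent.of_comp L'.subtype hf
    simpa using h.fintype_card_le_finrank

/-- **The local kernel.** The local kernels
`L x = {f | ∃ r > 0, ∀ y ∈ U₁, dist y x < r → ∀ j, ∑ᵢ fᵢ Ω j i y = 0}` form a family of real
subspaces of `ℝᵏ`. [folklore] -/
theorem uniformCells_exists_localKernel {n k : ℕ} (U₁ : Set (Fin n → ℝ))
    (Ω : Fin n → Fin k → (Fin n → ℝ) → ℝ) :
    ∃ L : (Fin n → ℝ) → Submodule ℝ (Fin k → ℝ), ∀ x f, f ∈ L x ↔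
      ∃ r : ℝ, 0 < r ∧ ∀ y ∈ U₁, dist y x < r → ∀ j, ∑ i, f i * Ω j i y = 0 := by
  refine ⟨fun x =>
    { carrier := {f | ∃ r : ℝ, 0 < r ∧ ∀ y ∈ U₁, dist y x < r → ∀ j, ∑ i, f i * Ω j i y = 0}
      add_mem' := ?_
      zero_mem' := ⟨1, one_pos, fun y _ _ j => by simp⟩
      smul_mem' := ?_ }, fun x f => Iff.rfl⟩
  · rintro f g ⟨r, hr, hf⟩ ⟨s, hs, hg⟩
    refine ⟨min r s, lt_min hr hs, fun y hy hd j => ?_⟩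
    simp only [Pi.add_apply, add_mul, Finset.sum_add_distrib,
      hf y hy (hd.trans_le (min_le_left _ _)) j, hg y hy (hd.trans_le (min_le_right _ _)) j,
      add_zero]
  · rintro c f ⟨r, hr, hf⟩
    refine ⟨r, hr, fun y hy hd j => ?_⟩
    simp only [Pi.smul_apply, smul_eq_mul, mul_assoc, ← Finset.mul_sum, hf y hy hd j, mul_zero]

/-- **Monotonicity of the local kernel**: a vector in the local kernel at `x` is in the local
kernel at every point near `x` (halve the radius). Here the local kernel is any family `L` with
`f ∈ L x ↔ ∃ r > 0, ∀ y ∈ U₁, dist y x < r → P y f`. [folklore] -/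
theorem uniformCells_eventually_mem {n k : ℕ} {U₁ : Set (Fin n → ℝ)}
    {P : (Fin n → ℝ) → (Fin k → ℝ) → Prop} {L : (Fin n → ℝ) → Submodule ℝ (Fin k → ℝ)}
    (hL : ∀ x f, f ∈ L x ↔ ∃ r : ℝ, 0 < r ∧ ∀ y ∈ U₁, dist y x < r → P y f)
    {x : Fin n → ℝ} {f : Fin k → ℝ} (hf : f ∈ L x) : ∀ᶠ y in 𝓝 x, f ∈ L y := by
  obtain ⟨r, hr, h⟩ := (hL x f).1 hf
  filter_upwards [Metric.ball_mem_nhds x (half_pos hr)] with y hy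
  refine (hL y f).2 ⟨r / 2, half_pos hr, fun z hz hzy => h z hz ?_⟩
  calc dist z x ≤ dist z y + dist y x := dist_triangle _ _ _
    _ < r / 2 + r / 2 := add_lt_add hzy hy
    _ = r := add_halves r

/-- The local kernel can only grow along convergence: `L x ≤ L y` for all `y` near `x` (apply
`uniformCells_eventually_mem` to a finite generating set of `L x`). [folklore] -/
theorem uniformCells_eventually_le {n k : ℕ} {U₁ : Set (Fin n → ℝ)}
    {P : (Fin n → ℝ) → (Fin k → ℝ) → Prop} {L : (Fin n → ℝ) → Submodule ℝ (Fin k → ℝ)}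
    (hL : ∀ x f, f ∈ L x ↔ ∃ r : ℝ, 0 < r ∧ ∀ y ∈ U₁, dist y x < r → P y f)
    (x : Fin n → ℝ) : ∀ᶠ y in 𝓝 x, L x ≤ L y := by
  obtain ⟨S, hS⟩ := (Module.Finite.iff_fg.mp inferInstance : (L x).FG)
  have h : ∀ᶠ y in 𝓝 x, ∀ s ∈ S, s ∈ L y :=
    (eventually_all_finset S).2 fun s hs =>
      uniformCells_eventually_mem hL (hS ▸ Submodule.subset_span hs)
  filter_upwards [h] with y hy
  rw [← hS]
  exact Submodule.span_le.2 hy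

/-- **Constancy of the local kernel on cells**: on a preconnected set on which `dim L` is constant,
the local kernel `L` is constant (`L x ≤ L y` near `x` and equal dimensions force `L x = L y`;
then chain along the preconnected set, `IsPreconnected.induction₂`). [folklore] -/
theorem uniformCells_eq_of_isPreconnected {n k : ℕ} {U₁ : Set (Fin n → ℝ)}
    {P : (Fin n → ℝ) → (Fin k → ℝ) → Prop} {L : (Fin n → ℝ) → Submodule ℝ (Fin k → ℝ)}
    (hL : ∀ x f, f ∈ L x ↔ ∃ r : ℝ, 0 < r ∧ ∀ y ∈ U₁, dist y x < r → P y f)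
    {C : Set (Fin n → ℝ)} (hC : IsPreconnected C) {d : ℕ}
    (hCd : ∀ x ∈ C, Module.finrank ℝ (L x) = d) {x y : Fin n → ℝ} (hx : x ∈ C) (hy : y ∈ C) :
    L x = L y := by
  refine hC.induction₂ (fun a b => L a = L b) (fun z hz => ?_)
    (fun _ _ _ _ _ _ h₁ h₂ => h₁.trans h₂) (fun _ _ _ _ h => h.symm) hx hy
  filter_upwards [nhdsWithin_le_nhds (uniformCells_eventually_le hL z), self_mem_nhdsWithin]
    with w hle hw
  exact Submodule.eq_of_le_of_finrank_eq hle (by rw [hCd z hz, hCd w hw])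

/-! ### Main theorem of this file: the strata are semialgebraic -/

/-- **The strata of the local kernel are semialgebraic**: with `L` the local kernel of
`ℚ`-semialgebraic `Ω j i` on a `ℚ`-semialgebraic `U₁`, each `{x ∈ U₁ | dim L x = d}` is
`ℚ`-semialgebraic (difference of two rank loci, `uniformCells_isSemialgebraic_rankLocus`).
[cite: BasuPollackRoy2006, Cor. 2.78 (§2.5.1)] -/
theorem uniformCells_isSemialgebraic_strata {n k : ℕ} {U₁ : Set (Fin n → ℝ)}
    (hU₁ : IsSemialgebraic ℚ U₁) {Ω : Fin n → Fin k → (Fin n → ℝ) → ℝ}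
    (hΩ : ∀ j i, IsSemialgebraicFunOn ℚ U₁ (Ω j i)) {L : (Fin n → ℝ) → Submodule ℝ (Fin k → ℝ)}
    (hL : ∀ x f, f ∈ L x ↔
      ∃ r : ℝ, 0 < r ∧ ∀ y ∈ U₁, dist y x < r → ∀ j, ∑ i, f i * Ω j i y = 0)
    (d : ℕ) : IsSemialgebraic ℚ {x | x ∈ U₁ ∧ Module.finrank ℝ (L x) = d} := by
  have hT : ∀ m : ℕ, IsSemialgebraic ℚ {x | x ∈ U₁ ∧ m ≤ Module.finrank ℝ (L x)} := fun m => by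
    convert uniformCells_isSemialgebraic_rankLocus hU₁ hΩ m using 1
    ext x
    simp only [mem_setOf_eq, uniformCells_le_finrank_iff, hL]
  convert (hT d).diff (hT (d + 1)) using 1
  ext x
  simp only [mem_setOf_eq, Set.mem_sdiff, not_and, not_le]
  constructor
  · rintro ⟨hx, h⟩
    exact ⟨⟨hx, h.ge⟩, fun _ => by omega⟩
  · rintro ⟨⟨hx, h1⟩, h2⟩
    exact ⟨hx, by have := h2 hx; omega⟩

/-- **The strata of the local kernel are semialgebraic** (registered form of
`uniformCells_isSemialgebraic_strata`, consumed by `stub_uniformCells`): for `ℚ`-semialgebraic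
`Ω j i` on a `ℚ`-semialgebraic `U₁ ⊆ ℝⁿ` and `L` their local kernel, every stratum
`{x ∈ U₁ | dim L x = d}` is `ℚ`-semialgebraic. [cite: BasuPollackRoy2006, Cor. 2.78 (§2.5.1)] -/
theorem uniformCells_strata : ∀ (n k : ℕ) (U₁ : Set (Fin n → ℝ))
    (Ω : Fin n → Fin k → (Fin n → ℝ) → ℝ) (L : (Fin n → ℝ) → Submodule ℝ (Fin k → ℝ)) (d : ℕ),
    IsSemialgebraic ℚ U₁ → (∀ j i, IsSemialgebraicFunOn ℚ U₁ (Ω j i)) →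
    (∀ x f, f ∈ L x ↔ ∃ r : ℝ, 0 < r ∧ ∀ y ∈ U₁, dist y x < r → ∀ j, ∑ i, f i * Ω j i y = 0) →
    IsSemialgebraic ℚ {x | x ∈ U₁ ∧ Module.finrank ℝ (L x) = d} :=
  fun _ _ _ _ _ d hU₁ hΩ hL => uniformCells_isSemialgebraic_strata hU₁ hΩ hL d

end Summit.KontsevichZagierPeriods.LiouvilleUnfolding.LogPrimitiveNL.AxSchanuelGerms

end
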